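import Literature.Topology.FourManifolds.TrisectionsCornerHadamard
import Mathlib.Geometry.Manifold.PartitionOfUnity
import Mathlib.Topology.Compactness.LocallyCompact
import HarnessLib

/-!
# Cornered Hadamard: `1 - f ∘ e⁻¹ = 2uv · K` near the central surface of a sector

Topic `Literature/Topology/FourManifolds`; infrastructure for the fact seat
`provefact-Literature.Topology.FourManifolds.exists-14560f9fc8` (named fact (c′)
`Literature.Topology.FourManifolds.exists_stabilized_gkTrisection`), continuing
`TrisectionsCornerHadamard.lean`.  Everything in this file is **proved**; no definitions,
no named facts.

**Theorem (`exists_cornerHadamard`).**  Let `e : W → X` be the sector manifold of the sector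
`S i` of a trisection with corners (a topological embedding with `range e = S i`, a corner
chart at every point over the central surface `F = ⋂ S l`, the faces `S i ∩ S j` images of
boundary points) and `f` its Morse function adapted to `∂W`; let `u, v` cut out
`S i = {u ≥ 0, v ≥ 0}`, its faces and `F = {u = v = 0}` in an open set `U`, and let `Ξ` be a
chart of the maximal atlas at `x ∈ F` with first coordinates `u, v`
(`IsGKTrisection.exists_normalCoordinates`).  Then on a neighbourhood `N` of `x` in `X`
`1 - f (e⁻¹ y) = 2 u(y) v(y) K(y)` for `y ∈ S i ∩ N`, with `K` smooth and positive on `N`.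

**Proof.**  In the corner chart `(φ, ψ, A)` of `e` at `e⁻¹ x`, `f ∘ φ⁻¹ = 1 - x₀ · c` with
`c > 0` (`exists_hadamard_of_isMorseAdapted`), and the half-space coordinate is
`x₀ = 2 u_o v_o` for the old normal coordinates `(u_o, v_o, ·, ·) = A⁻¹ψ`
(`symm_apply_mem_cornerQuadrant_of_eqOn`).  The product `u_o v_o`, read through `Ξ⁻¹`,
vanishes on both closed faces of the new quadrant (their points are boundary images, where
`f = 1`, so `x₀ c = 0` and `x₀ = 0`), hence equals `q₀ q₁ · P₂` with `P₂` smooth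
(`exists_quadrant_hadamard`, after cutting off by a bump function); `K = c(x(y)) · P₂(Ξ y)`.
At `x`, `P₂ = ∂₁∂₀(u_o v_o)` is the permanent of the normal block of the derivative of the
transition `A⁻¹ψ ∘ Ξ⁻¹`, positive by `permanent_pos_of_quadrant` (the transition preserves
the quadrant and the stratum: `stratum_of_isCornerAt`); shrink `N` to `{K > 0}`.
`exists_cornerHadamard_global` glues these local `K` along the compact `F` by a smooth
partition of unity (the identity is linear in `K`, positivity survives nonnegative combinations).

## References

* J. Milnor, *Morse theory*, Ann. of Math. Studies 51 (1963), §2 (Lemma 2.1) and §3.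
  [Milnor1963]
* D. Gay, R. Kirby, *Trisecting 4-manifolds*, Geom. Topol. 20 (2016) 3097–3132, Def. 1.
  [GayKirby2016]
* A. Douady, *Variétés à bord anguleux et voisinages tubulaires*, Séminaire H. Cartan 14
  (1961/62), exp. 1, §1 and §4. [Douady1961]
-/

open Set Function Filter
open scoped Topology ContDiff Manifold

noncomputable section

namespace Literature.Topology.FourManifolds

section SectorHadamard

universe u

variable {X : Type u} [TopologicalSpace X] [ChartedSpace (EuclideanSpace ℝ (Fin 4)) X]
  {S : Fin 3 → Set X}
  {W : Type u} [TopologicalSpace W] [ChartedSpace (EuclideanHalfSpace 4) W]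

/-- **Cornered Hadamard: the Morse function of a sector compared with the product of the
global normal coordinates near the central surface.**  Let `S` be a trisection with corners,
`e : W → X` the sector manifold of `S i` with its boundary-adapted Morse function `f` (clause
(ii)), `u, v` functions cutting out `S i = {u ≥ 0, v ≥ 0}`, its faces and `F = {u = v = 0}` in
an open set `U`, and `Ξ` a chart of the maximal atlas at `x ∈ F` whose first two coordinates are
`u, v` (`IsGKTrisection.exists_normalCoordinates`).  Then near `x`
**`1 - f ∘ e⁻¹ = 2 u v · K`** for a function `K` smooth and **positive** on a neighbourhood of
`x` in `X` (only the listed consequences of the trisection clauses are used, so the statement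
is phrased for a family of sets `S`).  (In the corner chart `(φ, ψ, A)` of `e` at `e⁻¹ x`,
`f ∘ φ⁻¹ = 1 - x₀ · c`
(`exists_hadamard_of_isMorseAdapted`) and `x₀ = 2 u_o v_o` for the old normal coordinates
`(u_o, v_o) = A⁻¹ψ`; the product `u_o v_o`, read in `Ξ`, vanishes on both faces of the new
quadrant — they are boundary images, where `f = 1` — hence is `u v · P₂` by
`exists_quadrant_hadamard`; positivity at `x` is `permanent_pos_of_quadrant` for the
transition `A⁻¹ψ ∘ Ξ⁻¹`.) [cite: Milnor1963, §2; GayKirby2016, Def. 1] -/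
theorem exists_cornerHadamard {i : Fin 3}
    {e : W → X} (he : Topology.IsEmbedding e) (hrange : range e = S i)
    (hcor : ∀ w, e w ∈ (⋂ l, S l) → IsCornerAt e w)
    (hbd : ∀ j, j ≠ i → S i ∩ S j ⊆ e '' (𝓡∂ 4).boundary W)
    {f : W → ℝ} (hf : IsMorseAdapted (𝓡∂ 4) f)
    {u v : X → ℝ} {U : Set X} (hUo : IsOpen U)
    (hSi : ∀ y ∈ U, y ∈ S i ↔ 0 ≤ u y ∧ 0 ≤ v y)
    (hF : ∀ y ∈ U, y ∈ (⋂ l, S l) ↔ u y = 0 ∧ v y = 0)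
    (hface : ∀ y ∈ U, y ∈ S i → (u y = 0 ∨ v y = 0) → ∃ j, j ≠ i ∧ y ∈ S j)
    {x : X} (hx : x ∈ ⋂ l, S l) (hxU : x ∈ U)
    {Ξ : OpenPartialHomeomorph X (EuclideanSpace ℝ (Fin 4))}
    (hΞ : Ξ ∈ IsManifold.maximalAtlas (𝓡 4) ∞ X) (hxΞ : x ∈ Ξ.source)
    (hΞuv : ∀ y ∈ Ξ.source, Ξ y 0 = u y ∧ Ξ y 1 = v y) :
    ∃ (N : Set X) (K : X → ℝ), IsOpen N ∧ x ∈ N ∧ ContMDiffOn (𝓡 4) 𝓘(ℝ, ℝ) ∞ K N ∧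
      (∀ y ∈ N, 0 < K y) ∧ ∀ w, e w ∈ N → 1 - f w = 2 * u (e w) * v (e w) * K (e w) := by
  -- ### the corner chart at `w₀ = e⁻¹ x` and the Hadamard form of `f` in it
  have hxS : x ∈ S i := mem_iInter.1 hx i
  obtain ⟨w₀, hw₀x⟩ : x ∈ range e := by rw [hrange]; exact hxS
  obtain ⟨φ, ψ, A, hφ, hψ, hw₀φ, hsrc, hw₀0, heq⟩ := (hcor w₀ (by rw [hw₀x]; exact hx)).exists_eqOn
  have hQfold : ∀ w ∈ φ.source, A.symm (ψ (e w)) ∈ cornerQuadrant ∧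
      cornerFold (A.symm (ψ (e w))) = φ.extend (𝓡∂ 4) w :=
    fun w hw => symm_apply_mem_cornerQuadrant_of_eqOn heq hw
  obtain ⟨r, c, hr, hcs, hc0, hcpos, hfc⟩ := exists_hadamard_of_isMorseAdapted hf hφ hw₀φ hw₀0
  have hφ0 : φ.extend (𝓡∂ 4) w₀ = 0 := extend_apply_eq_zero hw₀0
  have hxψ : x ∈ ψ.source := by rw [← hw₀x]; exact hsrc hw₀φ
  -- `e '' φ.source = range e ∩ O'`
  obtain ⟨O', hO'o, hO'e⟩ := he.isInducing.isOpen_iff.1 φ.open_source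
  -- the old normal coordinates and the half-space coordinate, as functions on `X`
  set Lin : X → EuclideanSpace ℝ (Fin 4) := fun y => A.symm (ψ y) with hLin
  set T : X → EuclideanSpace ℝ (Fin 4) := fun y => cornerFold (Lin y) with hT
  have hLins : ContMDiffOn (𝓡 4) 𝓘(ℝ, EuclideanSpace ℝ (Fin 4)) ∞ Lin ψ.source :=
    (contMDiff_iff_contDiff.2 A.symm.contDiff).comp_contMDiffOn (contMDiffOn_of_mem_maximalAtlas hψ)
  have hTs : ContMDiffOn (𝓡 4) 𝓘(ℝ, EuclideanSpace ℝ (Fin 4)) ∞ T ψ.source :=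
    (contMDiff_iff_contDiff.2 contDiff_cornerFold).comp_contMDiffOn hLins
  have hTx : T x = 0 := by
    show cornerFold (A.symm (ψ x)) = 0
    rw [← hw₀x, (hQfold w₀ hw₀φ).2, hφ0]
  -- `N₁`: the half-space coordinate in the ball where `c > 0` and the Hadamard form holds
  set N₁ : Set X := ψ.source ∩ T ⁻¹' Metric.ball 0 r with hN₁
  have hN₁o : IsOpen N₁ := hTs.continuousOn.isOpen_inter_preimage ψ.open_source Metric.isOpen_ball
  have hxN₁ : x ∈ N₁ :=
    ⟨hxψ, by show T x ∈ Metric.ball 0 r; rw [hTx]; exact Metric.mem_ball_self hr⟩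
  -- the basic neighbourhood `N₀` of `x`
  set N₀ : Set X := O' ∩ U ∩ N₁ with hN₀
  have hN₀o : IsOpen N₀ := (hO'o.inter hUo).inter hN₁o
  have hxN₀ : x ∈ N₀ := ⟨⟨by
    have : w₀ ∈ e ⁻¹' O' := by rw [hO'e]; exact hw₀φ
    rw [← hw₀x]; exact this, hxU⟩, hxN₁⟩
  -- for `e w ∈ N₀`: `w ∈ φ.source` and `1 - f w = 2 u_o v_o · c (T (e w))`
  have hwφ : ∀ w, e w ∈ O' → w ∈ φ.source := fun w hw => by
    have : w ∈ e ⁻¹' O' := hw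
    rwa [hO'e] at this
  have hold : ∀ w, e w ∈ N₀ →
      1 - f w = 2 * (Lin (e w) 0 * Lin (e w) 1) * c (T (e w)) := by
    intro w hw
    have hwφ' : w ∈ φ.source := hwφ w hw.1.1
    have hTw : T (e w) = φ.extend (𝓡∂ 4) w := (hQfold w hwφ').2
    have h1 := hfc w hwφ' (by rw [← hTw]; exact hw.2.2)
    rw [← hTw] at h1
    have hT0 : T (e w) 0 = 2 * Lin (e w) 0 * Lin (e w) 1 := cornerFold_apply_zero _
    rw [h1, hT0]; ring
  -- boundary images have `T₀ = 0`, i.e. `u_o v_o = 0`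
  have hbdry0 : ∀ w, e w ∈ N₀ → (𝓡∂ 4).IsBoundaryPoint w → Lin (e w) 0 * Lin (e w) 1 = 0 := by
    intro w hw hwb
    have hf1 : f w = 1 := (hf.2.1 w hwb).1
    have h1 := hold w hw
    rw [hf1, sub_self] at h1
    have hcp : 0 < c (T (e w)) := hcpos _ hw.2.2
    nlinarith [h1, hcp]
  -- ### the transition `σ = A⁻¹ψ ∘ Ξ⁻¹` and the product `P̂ = σ₀ σ₁`
  set q₀ : EuclideanSpace ℝ (Fin 4) := Ξ x with hq₀
  have hq₀0 : q₀ 0 = 0 ∧ q₀ 1 = 0 := by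
    obtain ⟨h0, h1⟩ := hΞuv x hxΞ
    obtain ⟨hu0, hv0⟩ := (hF x hxU).1 hx
    exact ⟨by rw [hq₀, h0, hu0], by rw [hq₀, h1, hv0]⟩
  set σ : EuclideanSpace ℝ (Fin 4) → EuclideanSpace ℝ (Fin 4) := fun z => Lin (Ξ.symm z) with hσ
  set D : Set (EuclideanSpace ℝ (Fin 4)) := Ξ.target ∩ Ξ.symm ⁻¹' N₀ with hD
  have hDo : IsOpen D := Ξ.continuousOn_symm.isOpen_inter_preimage Ξ.open_target hN₀o
  have hq₀D : q₀ ∈ D :=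
    ⟨Ξ.map_source hxΞ, by show Ξ.symm (Ξ x) ∈ N₀; rw [Ξ.left_inv hxΞ]; exact hxN₀⟩
  have hDfacts : ∀ z ∈ D, Ξ.symm z ∈ Ξ.source ∧ Ξ.symm z ∈ N₀ ∧ Ξ (Ξ.symm z) = z ∧
      u (Ξ.symm z) = z 0 ∧ v (Ξ.symm z) = z 1 := by
    intro z hz
    have h1 : Ξ.symm z ∈ Ξ.source := Ξ.map_target hz.1
    have h2 : Ξ (Ξ.symm z) = z := Ξ.right_inv hz.1
    obtain ⟨hu, hv⟩ := hΞuv _ h1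
    rw [h2] at hu hv
    exact ⟨h1, hz.2, h2, hu.symm, hv.symm⟩
  have hσs : ContDiffOn ℝ ∞ σ D := by
    have h1 : ContMDiffOn 𝓘(ℝ, EuclideanSpace ℝ (Fin 4)) (𝓡 4) ∞ Ξ.symm Ξ.target :=
      contMDiffOn_symm_of_mem_maximalAtlas hΞ
    have h2 : ContMDiffOn 𝓘(ℝ, EuclideanSpace ℝ (Fin 4)) 𝓘(ℝ, EuclideanSpace ℝ (Fin 4)) ∞ σ D :=
      hLins.comp (h1.mono inter_subset_left) fun z hz => (hDfacts z hz).2.1.2.1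
    exact contMDiffOn_iff_contDiffOn.mp h2
  set Phat : EuclideanSpace ℝ (Fin 4) → ℝ := fun z => σ z 0 * σ z 1 with hPhat
  have hproj : ∀ i : Fin 4, ContDiff ℝ ∞ fun q : EuclideanSpace ℝ (Fin 4) => q i := fun i =>
    contDiff_piLp_apply (p := 2) (i := i)
  have hPhats : ContDiffOn ℝ ∞ Phat D :=
    ((hproj 0).comp_contDiffOn hσs).mul ((hproj 1).comp_contDiffOn hσs)
  -- `P̂` vanishes at the (closed) face points of the new quadrant inside `D`
  have hPvan : ∀ z ∈ D, 0 ≤ z 0 → 0 ≤ z 1 → (z 0 = 0 ∨ z 1 = 0) → Phat z = 0 := by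
    intro z hz hz0 hz1 hzface
    obtain ⟨hysrc, hyN₀, hΞy, huy, hvy⟩ := hDfacts z hz
    set y := Ξ.symm z with hy
    have hyU : y ∈ U := hyN₀.1.2
    have hyS : y ∈ S i := (hSi y hyU).2 ⟨by rw [huy]; exact hz0, by rw [hvy]; exact hz1⟩
    obtain ⟨j, hji, hyj⟩ := hface y hyU hyS (by rw [huy, hvy]; exact hzface)
    obtain ⟨w, hwb, hwy⟩ := hbd j hji ⟨hyS, hyj⟩
    have hwN₀ : e w ∈ N₀ := by rw [hwy]; exact hyN₀
    have := hbdry0 w hwN₀ hwb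
    rw [hwy] at this
    exact this
  -- a ball in `D`, a bump function and the globalised `P̃`
  obtain ⟨r₂, hr₂, hball₂⟩ := Metric.isOpen_iff.1 hDo q₀ hq₀D
  set β₂ : ContDiffBump q₀ := ⟨r₂ / 4, r₂ / 2, by linarith, by linarith⟩ with hβ₂
  set Ptil : EuclideanSpace ℝ (Fin 4) → ℝ := fun z => β₂ z * Phat z with hPtil
  have hPtils : ContDiff ℝ ∞ Ptil :=
    contDiff_bump_mul' (hPhats.mono hball₂) β₂ (by show r₂ / 2 < r₂; linarith)
  have hPtileq : ∀ z ∈ Metric.ball q₀ (r₂ / 4), Ptil z = Phat z := by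
    intro z hz
    have : β₂ z = 1 := β₂.one_of_mem_closedBall (Metric.ball_subset_closedBall hz)
    simp only [hPtil, this, one_mul]
  have hPtil0 : ∀ z ∈ Metric.ball q₀ r₂, z 0 = 0 → 0 ≤ z 1 → Ptil z = 0 := fun z hz hz0 hz1 => by
    simp only [hPtil, hPvan z (hball₂ hz) (le_of_eq hz0.symm) hz1 (Or.inl hz0), mul_zero]
  have hPtil1 : ∀ z ∈ Metric.ball q₀ r₂, z 1 = 0 → 0 ≤ z 0 → Ptil z = 0 := fun z hz hz1 hz0 => by
    simp only [hPtil, hPvan z (hball₂ hz) hz0 (le_of_eq hz1.symm) (Or.inr hz1), mul_zero]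
  obtain ⟨P₂, hP₂s, hP₂eq, hP₂val⟩ := exists_quadrant_hadamard hPtils hq₀0.1 hq₀0.2 hPtil0 hPtil1
  -- ### the function `K`
  set K : X → ℝ := fun y => c (T y) * P₂ (Ξ y) with hK
  set N : Set X := N₀ ∩ Ξ.source ∩ Ξ ⁻¹' Metric.ball q₀ (r₂ / 4) with hN
  have hNo : IsOpen N := by
    rw [hN, inter_assoc]
    exact hN₀o.inter (Ξ.continuousOn.isOpen_inter_preimage Ξ.open_source Metric.isOpen_ball)
  have hxN : x ∈ N := ⟨⟨hxN₀, hxΞ⟩, by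
    show Ξ x ∈ Metric.ball q₀ (r₂ / 4); exact Metric.mem_ball_self (by linarith)⟩
  have hKs : ContMDiffOn (𝓡 4) 𝓘(ℝ, ℝ) ∞ K N := by
    have h1 : ContMDiffOn (𝓡 4) 𝓘(ℝ, ℝ) ∞ (fun y => c (T y)) ψ.source :=
      (contMDiff_iff_contDiff.2 hcs).comp_contMDiffOn hTs
    have h2 : ContMDiffOn (𝓡 4) 𝓘(ℝ, ℝ) ∞ (fun y => P₂ (Ξ y)) Ξ.source :=
      (contMDiff_iff_contDiff.2 hP₂s).comp_contMDiffOn (contMDiffOn_of_mem_maximalAtlas hΞ)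
    exact (h1.mono fun y hy => hy.1.1.2.1).mul (h2.mono fun y hy => hy.1.2)
  -- the identity `1 - f = 2 u v K` on `e ⁻¹ N`
  have hident : ∀ w, e w ∈ N → 1 - f w = 2 * u (e w) * v (e w) * K (e w) := by
    intro w hw
    obtain ⟨⟨hwN₀, hwΞ⟩, hwball⟩ := hw
    have hwball' : Ξ (e w) ∈ Metric.ball q₀ (r₂ / 4) := hwball
    have hzD : Ξ (e w) ∈ D := hball₂ (Metric.ball_subset_ball (by linarith) hwball')
    have hsymm : Ξ.symm (Ξ (e w)) = e w := Ξ.left_inv hwΞ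
    obtain ⟨hu, hv⟩ := hΞuv _ hwΞ
    have hwS : e w ∈ S i := by rw [← hrange]; exact mem_range_self w
    obtain ⟨hu0, hv0⟩ := (hSi _ hwN₀.1.2).1 hwS
    have h1 := hold w hwN₀
    have h2 : Lin (e w) 0 * Lin (e w) 1 = Phat (Ξ (e w)) := by
      simp only [hPhat, hσ, hsymm]
    have h3 : Phat (Ξ (e w)) = Ptil (Ξ (e w)) := (hPtileq _ hwball').symm
    have h4 := hP₂eq (Ξ (e w)) (Metric.ball_subset_ball (by linarith) hwball')
      (by rw [hu]; exact hu0) (by rw [hv]; exact hv0)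
    rw [h1, h2, h3, h4, hu, hv]
    simp only [hK]
    ring
  -- ### positivity at `x`: the permanent
  have hKx : 0 < K x := by
    have hKx' : K x = c 0 * P₂ q₀ := by simp only [hK, hTx, hq₀]
    rw [hKx']
    refine mul_pos hc0 ?_
    -- `P₂ q₀ = ∂₁∂₀ P̃ (q₀) = ∂₁∂₀ P̂ (q₀)`, computed from `P̂ = σ₀ σ₁`
    rw [hP₂val]
    -- derivative data of `σ` at `q₀`
    have hq₀x : Ξ.symm q₀ = x := by rw [hq₀]; exact Ξ.left_inv hxΞ
    have hσq₀ : σ q₀ = Lin x := by simp only [hσ, hq₀x]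
    have hballD : Metric.ball q₀ r₂ ⊆ D := hball₂
    have hσd : ∀ z ∈ Metric.ball q₀ r₂, HasFDerivAt σ (fderiv ℝ σ z) z := fun z hz =>
      ((hσs.contDiffAt (hDo.mem_nhds (hballD hz))).differentiableAt (by simp)).hasFDerivAt
    set L := fderiv ℝ σ q₀ with hL
    have hσq₀d : HasFDerivAt σ L q₀ := hσd q₀ (Metric.mem_ball_self hr₂)
    -- injectivity of `L`: `σ` is a transition between charts of the maximal atlas
    have hLinj : Injective L := by
      have := injective_fderiv_transition (A := A) (A' := ContinuousLinearEquiv.refl ℝ _) hψ hΞ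
        hxψ hxΞ
      simpa [hσ, hLin, hL, hq₀] using this
    -- the quadrant and stratum hypotheses
    have hDnhds : D ∈ 𝓝 q₀ := hDo.mem_nhds hq₀D
    have hQ : ∀ᶠ z in 𝓝 q₀, (0 ≤ z 0 ∧ 0 ≤ z 1) → (0 ≤ σ z 0 ∧ 0 ≤ σ z 1) := by
      filter_upwards [hDnhds] with z hz hzq
      obtain ⟨hysrc, hyN₀, hΞy, huy, hvy⟩ := hDfacts z hz
      have hyS : Ξ.symm z ∈ S i :=
        (hSi _ hyN₀.1.2).2 ⟨by rw [huy]; exact hzq.1, by rw [hvy]; exact hzq.2⟩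
      rw [← hrange] at hyS
      obtain ⟨w, hw⟩ := hyS
      have hwφ' : w ∈ φ.source := hwφ w (by rw [hw]; exact hyN₀.1.1)
      have hQw := (hQfold w hwφ').1
      rw [hw] at hQw
      exact hQw
    have hstr : ∀ᶠ z in 𝓝 q₀, (z 0 = 0 ∧ z 1 = 0) → (σ z 0 = 0 ∧ σ z 1 = 0) := by
      filter_upwards [hDnhds] with z hz hzq
      obtain ⟨hysrc, hyN₀, hΞy, huy, hvy⟩ := hDfacts z hz
      have hyF : Ξ.symm z ∈ ⋂ l, S l :=
        (hF _ hyN₀.1.2).2 ⟨by rw [huy]; exact hzq.1, by rw [hvy]; exact hzq.2⟩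
      have hyS : Ξ.symm z ∈ range e := by rw [hrange]; exact mem_iInter.1 hyF i
      obtain ⟨w, hw⟩ := hyS
      have hwφ' : w ∈ φ.source := hwφ w (by rw [hw]; exact hyN₀.1.1)
      have hst := stratum_of_isCornerAt hφ hψ hsrc heq hwφ' (hcor w (by rw [hw]; exact hyF))
      have hLw : Lin (e w) = cornerUnbend (φ.extend (𝓡∂ 4) w) := by
        show A.symm (ψ (e w)) = cornerUnbend (φ.extend (𝓡∂ 4) w)
        rw [apply_eq_cornerUnbend_of_eqOn heq hwφ', ContinuousLinearEquiv.symm_apply_apply]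
      have : σ z = Lin (e w) := by simp only [hσ, hw]
      rw [this, hLw]
      exact cornerUnbend_apply_eq_zero_of_stratum hst.1 hst.2
    obtain ⟨-, hperm⟩ := permanent_pos_of_quadrant hσq₀d hLinj hq₀0 hQ hstr
    -- ### the mixed partial of `P̃` at `q₀` is the permanent
    set e0 : EuclideanSpace ℝ (Fin 4) := EuclideanSpace.single 0 1 with he0
    set e1 : EuclideanSpace ℝ (Fin 4) := EuclideanSpace.single 1 1 with he1
    -- the coordinate functions of `σ` and their derivatives
    set σ0 : EuclideanSpace ℝ (Fin 4) → ℝ := fun z => σ z 0 with hσ0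
    set σ1 : EuclideanSpace ℝ (Fin 4) → ℝ := fun z => σ z 1 with hσ1
    have hσ0d : ∀ z ∈ Metric.ball q₀ r₂,
        HasFDerivAt σ0 ((EuclideanSpace.proj (𝕜 := ℝ) (0 : Fin 4)).comp (fderiv ℝ σ z)) z :=
      fun z hz => (EuclideanSpace.proj (𝕜 := ℝ) (0 : Fin 4)).hasFDerivAt.comp z (hσd z hz)
    have hσ1d : ∀ z ∈ Metric.ball q₀ r₂,
        HasFDerivAt σ1 ((EuclideanSpace.proj (𝕜 := ℝ) (1 : Fin 4)).comp (fderiv ℝ σ z)) z :=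
      fun z hz => (EuclideanSpace.proj (𝕜 := ℝ) (1 : Fin 4)).hasFDerivAt.comp z (hσd z hz)
    -- `∂₀P̃ = σ₀ ∂₀σ₁ + σ₁ ∂₀σ₀` near `q₀`
    set g0 : EuclideanSpace ℝ (Fin 4) → ℝ := fun z => fderiv ℝ σ z e0 0 with hg0
    set g1 : EuclideanSpace ℝ (Fin 4) → ℝ := fun z => fderiv ℝ σ z e0 1 with hg1
    have hfd : ∀ z ∈ Metric.ball q₀ (r₂ / 4), fderiv ℝ Ptil z e0 = σ0 z * g1 z + σ1 z * g0 z := by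
      intro z hz
      have hz' : z ∈ Metric.ball q₀ r₂ := Metric.ball_subset_ball (by linarith) hz
      have hev : Ptil =ᶠ[𝓝 z] Phat := by
        filter_upwards [Metric.isOpen_ball.mem_nhds hz] with z' hz'
        exact hPtileq z' hz'
      rw [hev.fderiv_eq]
      have hm : HasFDerivAt (fun z => σ0 z * σ1 z) _ z := (hσ0d z hz').mul (hσ1d z hz')
      have : Phat = fun z => σ0 z * σ1 z := rfl
      rw [this, hm.fderiv]
      simp only [add_apply, smul_apply, ContinuousLinearMap.comp_apply, smul_eq_mul, hg0, hg1]
      rfl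
    -- smoothness of `g0`, `g1` at `q₀` (`σ ∈ C²` near `q₀`)
    have hσC : ContDiffAt ℝ ∞ σ q₀ := hσs.contDiffAt hDnhds
    have hdσ : ContDiffAt ℝ ∞ (fun z => fderiv ℝ σ z e0) q₀ :=
      (hσC.fderiv_right (m := ∞) le_rfl).clm_apply contDiffAt_const
    have hg0d : DifferentiableAt ℝ g0 q₀ :=
      (((hproj 0).contDiffAt).comp q₀ hdσ).differentiableAt (by simp)
    have hg1d : DifferentiableAt ℝ g1 q₀ :=
      (((hproj 1).contDiffAt).comp q₀ hdσ).differentiableAt (by simp)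
    have hσ0q : σ0 q₀ = 0 := by
      have := hstr.self_of_nhds hq₀0; exact this.1
    have hσ1q : σ1 q₀ = 0 := by
      have := hstr.self_of_nhds hq₀0; exact this.2
    -- derivative of `σ₀ g₁ + σ₁ g₀` at `q₀` in the direction `e₁`
    have hq₀r : q₀ ∈ Metric.ball q₀ r₂ := Metric.mem_ball_self hr₂
    have hsum : HasFDerivAt (fun z => σ0 z * g1 z + σ1 z * g0 z)
        (σ0 q₀ • fderiv ℝ g1 q₀ + g1 q₀ • (EuclideanSpace.proj (𝕜 := ℝ) (0 : Fin 4)).comp L +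
          (σ1 q₀ • fderiv ℝ g0 q₀ +
            g0 q₀ • (EuclideanSpace.proj (𝕜 := ℝ) (1 : Fin 4)).comp L)) q₀ :=
      ((hσ0d q₀ hq₀r).mul hg1d.hasFDerivAt).add ((hσ1d q₀ hq₀r).mul hg0d.hasFDerivAt)
    rw [hσ0q, hσ1q, zero_smul, zero_add, zero_smul, zero_add] at hsum
    have hfd' : (fun z => fderiv ℝ Ptil z e0) =ᶠ[𝓝 q₀] fun z => σ0 z * g1 z + σ1 z * g0 z := by
      filter_upwards [Metric.isOpen_ball.mem_nhds
        (Metric.mem_ball_self (by linarith : (0:ℝ) < r₂ / 4))] with z hz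
      exact hfd z hz
    rw [hfd'.fderiv_eq, hsum.fderiv]
    simp only [add_apply, smul_apply, ContinuousLinearMap.comp_apply, smul_eq_mul, hg0, hg1]
    -- match with the permanent
    have e0' : EuclideanSpace.proj (𝕜 := ℝ) (0 : Fin 4) (L e1) = L e1 0 := rfl
    have e1' : EuclideanSpace.proj (𝕜 := ℝ) (1 : Fin 4) (L e1) = L e1 1 := rfl
    rw [e0', e1', ← hL]
    nlinarith [hperm, mul_comm (L e0 1) (L e1 0), mul_comm (L e0 0) (L e1 1)]
  -- ### shrink to `{K > 0}`
  set N' : Set X := N ∩ K ⁻¹' Ioi 0 with hN'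
  have hN'o : IsOpen N' := hKs.continuousOn.isOpen_inter_preimage hNo isOpen_Ioi
  refine ⟨N', K, hN'o, ⟨hxN, hKx⟩, hKs.mono inter_subset_left, fun y hy => hy.2,
    fun w hw => hident w hw.1⟩

end SectorHadamard

section GlobalK

universe u

variable {X : Type u} [TopologicalSpace X] [T2Space X] [CompactSpace X]
  [ChartedSpace (EuclideanSpace ℝ (Fin 4)) X] [IsManifold (𝓡 4) ∞ X]
  {S : Fin 3 → Set X}
  {W : Type u} [TopologicalSpace W] [ChartedSpace (EuclideanHalfSpace 4) W]

/-- **Cornered Hadamard along the whole central surface.**  Under the hypotheses of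
`exists_cornerHadamard` at every point of the compact central surface `F = ⋂ S l` (adapted
charts from `IsGKTrisection.exists_normalCoordinates`), there are an open `O ⊇ F` and a smooth
`K : X → ℝ`, positive on `O`, with `1 - f ∘ e⁻¹ = 2 u v · K` on `S i ∩ O` (glue the local
functions `K_x` by a smooth partition of unity on a compact neighbourhood of `F` subordinate to
their domains: each identity is linear in `K`, and positivity is preserved by nonnegative
combinations). [cite: Milnor1963, §2; GayKirby2016, Def. 1] -/
theorem exists_cornerHadamard_global {i : Fin 3}
    {e : W → X} (he : Topology.IsEmbedding e) (hrange : range e = S i)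
    (hcor : ∀ w, e w ∈ (⋂ l, S l) → IsCornerAt e w)
    (hbd : ∀ j, j ≠ i → S i ∩ S j ⊆ e '' (𝓡∂ 4).boundary W)
    {f : W → ℝ} (hf : IsMorseAdapted (𝓡∂ 4) f)
    {u v : X → ℝ} {U : Set X} (hUo : IsOpen U)
    (hSi : ∀ y ∈ U, y ∈ S i ↔ 0 ≤ u y ∧ 0 ≤ v y)
    (hF : ∀ y ∈ U, y ∈ (⋂ l, S l) ↔ u y = 0 ∧ v y = 0)
    (hface : ∀ y ∈ U, y ∈ S i → (u y = 0 ∨ v y = 0) → ∃ j, j ≠ i ∧ y ∈ S j)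
    (hFU : (⋂ l, S l) ⊆ U) (hFc : IsCompact (⋂ l, S l))
    (hchart : ∀ x ∈ ⋂ l, S l, ∃ Ξ : OpenPartialHomeomorph X (EuclideanSpace ℝ (Fin 4)),
      Ξ ∈ IsManifold.maximalAtlas (𝓡 4) ∞ X ∧ x ∈ Ξ.source ∧
      ∀ y ∈ Ξ.source, Ξ y 0 = u y ∧ Ξ y 1 = v y) :
    ∃ (O : Set X) (K : X → ℝ), IsOpen O ∧ (⋂ l, S l) ⊆ O ∧ ContMDiff (𝓡 4) 𝓘(ℝ, ℝ) ∞ K ∧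
      (∀ y ∈ O, 0 < K y) ∧ ∀ w, e w ∈ O → 1 - f w = 2 * u (e w) * v (e w) * K (e w) := by
  haveI : LocallyCompactSpace X := ChartedSpace.locallyCompactSpace (EuclideanSpace ℝ (Fin 4)) X
  set F : Set X := ⋂ l, S l with hFdef
  -- local data at the points of `F`
  have hloc : ∀ x : F, ∃ (N : Set X) (K : X → ℝ), IsOpen N ∧ (x : X) ∈ N ∧
      ContMDiffOn (𝓡 4) 𝓘(ℝ, ℝ) ∞ K N ∧ (∀ y ∈ N, 0 < K y) ∧
      ∀ w, e w ∈ N → 1 - f w = 2 * u (e w) * v (e w) * K (e w) := by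
    intro x
    obtain ⟨Ξ, hΞ, hxΞ, hΞuv⟩ := hchart x x.2
    exact exists_cornerHadamard he hrange hcor hbd hf hUo hSi hF hface x.2 (hFU x.2) hΞ hxΞ hΞuv
  choose N K hNo hxN hKs hKpos hKid using hloc
  -- a compact neighbourhood of `F` inside the union of the domains
  have hcover : F ⊆ ⋃ x : F, N x := fun y hy => mem_iUnion.2 ⟨⟨y, hy⟩, hxN ⟨y, hy⟩⟩
  obtain ⟨C, hCc, hFC, hCN⟩ := exists_compact_between hFc (isOpen_iUnion fun x => hNo x) hcover
  -- a smooth partition of unity on `C` subordinate to the domains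
  obtain ⟨ρ, hρ⟩ := SmoothPartitionOfUnity.exists_isSubordinate (ι := F) (I := 𝓡 4) (M := X)
    hCc.isClosed (fun x => N x) (fun x => hNo x) hCN
  set Kg : X → ℝ := fun y => ∑ᶠ x, ρ x y * K x y with hKg
  have hKgs : ContMDiff (𝓡 4) 𝓘(ℝ, ℝ) ∞ Kg :=
    ρ.contMDiff_finsum_smul (n := ⊤) (g := fun x y => K x y) fun x y hy =>
      (hKs x).contMDiffAt ((hNo x).mem_nhds (hρ x hy))
  -- finite active sets
  have hfin : ∀ y, (Function.support fun x => ρ x y).Finite := fun y =>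
    ρ.locallyFinite.point_finite y
  have hsum : ∀ y (t : F → ℝ), (∑ᶠ x, ρ x y * t x) = ∑ x ∈ (hfin y).toFinset, ρ x y * t x := by
    intro y t
    apply finsum_eq_sum_of_support_subset
    intro x hx
    rw [Function.mem_support] at hx
    rw [Finset.mem_coe, Set.Finite.mem_toFinset, Function.mem_support]
    exact fun h0 => hx (by rw [h0, zero_mul])
  have hactive : ∀ y x, ρ x y ≠ 0 → y ∈ N x := fun y x hx =>
    hρ x (subset_tsupport _ (Function.mem_support.2 hx))
  refine ⟨interior C, Kg, isOpen_interior, hFC, hKgs, fun y hy => ?_, fun w hw => ?_⟩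
  · -- positivity on `C`
    have hyC : y ∈ C := interior_subset hy
    obtain ⟨x₀, hx₀⟩ := ρ.exists_pos_of_mem (x := y) hyC
    have hterm : ∀ x ∈ (hfin y).toFinset, 0 ≤ ρ x y * K x y := by
      intro x hx
      rw [Set.Finite.mem_toFinset, Function.mem_support] at hx
      exact mul_nonneg (ρ.nonneg x y) (hKpos x y (hactive y x hx)).le
    have hx₀mem : x₀ ∈ (hfin y).toFinset := by
      rw [Set.Finite.mem_toFinset, Function.mem_support]; exact hx₀.ne'
    show 0 < Kg y
    rw [hKg]; dsimp only; rw [hsum y fun x => K x y]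
    calc (0:ℝ) < ρ x₀ y * K x₀ y := mul_pos hx₀ (hKpos x₀ y (hactive y x₀ hx₀.ne'))
      _ ≤ ∑ x ∈ (hfin y).toFinset, ρ x y * K x y := Finset.single_le_sum hterm hx₀mem
  · -- the identity on `C`
    set y := e w with hy
    have hyC : y ∈ C := interior_subset hw
    set A := (hfin y).toFinset with hA
    have hmemA : ∀ x, x ∈ A ↔ ρ x y ≠ 0 := fun x => by
      rw [hA, Set.Finite.mem_toFinset, Function.mem_support]
    have hsum1 : ∑ x ∈ A, ρ x y = 1 := by
      have h1 : ∑ᶠ x, ρ x y = 1 := ρ.sum_eq_one hyC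
      have h2 := hsum y fun _ => 1
      simp only [mul_one] at h2
      rw [← h2]; exact h1
    have hKgA : Kg y = ∑ x ∈ A, ρ x y * K x y := hsum y fun x => K x y
    calc 1 - f w = (∑ x ∈ A, ρ x y) * (1 - f w) := by rw [hsum1, one_mul]
      _ = ∑ x ∈ A, ρ x y * (1 - f w) := Finset.sum_mul _ _ _
      _ = ∑ x ∈ A, ρ x y * (2 * u y * v y * K x y) := by
          refine Finset.sum_congr rfl fun x hx => ?_
          rw [hKid x w (hactive y x ((hmemA x).1 hx))]
      _ = 2 * u y * v y * ∑ x ∈ A, ρ x y * K x y := by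
          rw [Finset.mul_sum]
          exact Finset.sum_congr rfl fun x _ => by ring
      _ = 2 * u y * v y * Kg y := by rw [hKgA]

end GlobalK

end Literature.Topology.FourManifolds
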